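import Mathlib
import Summits.Ventures.HodgeRepro.LitRank
import Summits.Ventures.HodgeRepro.LitRankChar

/-!
# LitRankCyclic — Yanai's Lemma (cyclic Galois CM fields of degree `2d`, `d` an odd prime)

Blind cell `pub-hodge-repro`, seat lit-2 (gen 3).  Companion of `LitRank.lean` / `LitRankChar.lean`
(same seat).  Yanai 1985, *On the rank of CM-type*, Nagoya Math. J. 97, Lemma p.171 (store
`paper:doi-10-1017-s0027763000021292` p0003:L31–48), typed in `LitRank.lean` as
`Yanai1985_lemma_cyclic_nondegenerate`:

  "LEMMA.  Let G₀ be a cyclic group of order 2d (d = odd prime).  Then every simple CM-type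
  (G₀,{1},S) is non-degenerate."

The PRINTED proof is followed step by step: "by Kubota [1], there exists an odd character χ of
G₀ such that Σ_{s∈S} χ(s) = 0 (*)" (Kubota's character formula = `Kubota_rank_abelian_charFormula`,
discharged by seat typer-2; the odd characters number `d`, `LitRankChar.two_mul_card_odd_char`) —
"The order of χ must be 2d from (*)" (`sum_pm_one_ne_zero`: an odd character of order 2 gives a
sum of `d` terms `±1`, `d` odd) — "ζ = χ(γ) is a primitive 2d-th root of unity.  Hence (*) must be
of the form [a full coset pattern]" (`coeffs_eq_of_sum_pow_eq_zero`: the only length-`d` relation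
among the powers of the primitive `d`-th root `−ζ` is the geometric one, minimal polynomial
`Φ_d`) — "This implies that the CM-type is not simple" (the pattern `γ^j ∈ S̃ ⇔ c(−1)^j = 1` makes
`S̃` stable under `γ²`, `γ² ≠ 1`).

Main results
* `charSum_ne_zero_of_odd_of_cyclic` — the contrapositive of Yanai's argument: for a simple
  CM-type on a cyclic group of order `2d` every odd character has `Σ_{s∈S̃} χ(s) ≠ 0`;
* `Yanai1985_lemma_cyclic_nondegenerate_of_charFormula :
    Kubota_rank_abelian_charFormula → Yanai1985_lemma_cyclic_nondegenerate`.

The unconditional `Yanai1985_lemma_cyclic_nondegenerate_holds` lives in `LitRankHolds.lean`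
(imports typer-2's `KubotaLit2.lean`).  This is the degree-6 cyclic Galois case (`G = ℤ/6`) of the
cell's Tier-2 (a) by a printed argument rather than by enumeration.  No new named fact is
introduced (D-0026).
-/

open Finset Polynomial
open scoped Pointwise

namespace HodgeRepro.Lit2

/-- The only `ℤ`-linear relation of length `d` among `1, η, …, η^{d−1}` for a primitive `d`-th
root of unity `η ∈ ℂ`, `d` prime, is the geometric one: if `Σ_{j<d} a_j η^j = 0` then all `a_j`
are equal.  (Minimal polynomial `Φ_d` of degree `d − 1`.) -/
theorem coeffs_eq_of_sum_pow_eq_zero {d : ℕ} (hd : d.Prime) {η : ℂ} (hη : IsPrimitiveRoot η d)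
    (a : ℕ → ℤ) (h : ∑ j ∈ range d, (a j : ℂ) * η ^ j = 0) : ∀ j < d, a j = a (d - 1) := by
  have hd1 : 1 < d := hd.one_lt
  set c : ℤ := a (d - 1) with hc
  set p : ℚ[X] := ∑ j ∈ range d, C ((a j : ℚ) - (c : ℚ)) * X ^ j with hp
  have hgeom : ∑ j ∈ range d, η ^ j = 0 := hη.geom_sum_eq_zero hd1
  have hpη : aeval η p = 0 := by
    have : aeval η p = ∑ j ∈ range d, ((a j : ℂ) - (c : ℂ)) * η ^ j := by
      simp only [hp, map_sum, map_mul, aeval_C, map_pow, aeval_X, eq_ratCast]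
      push_cast
      rfl
    rw [this, Finset.sum_congr rfl (fun j _ => sub_mul (a j : ℂ) (c : ℂ) (η ^ j)),
      Finset.sum_sub_distrib, h, ← Finset.mul_sum, hgeom, mul_zero, sub_zero]
  have hdeg : p.natDegree ≤ d - 2 := by
    refine natDegree_sum_le_of_forall_le _ _ (fun j hj => ?_)
    rw [Finset.mem_range] at hj
    by_cases hjd : j = d - 1
    · subst hjd
      rw [hc, sub_self, map_zero, zero_mul, natDegree_zero]
      exact Nat.zero_le _
    · exact (natDegree_C_mul_X_pow_le _ _).trans (by omega)
  have hp0 : p = 0 := by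
    by_contra hne
    have h1 : (minpoly ℚ η).natDegree ≤ p.natDegree :=
      natDegree_le_of_dvd (minpoly.dvd ℚ η hpη) hne
    have h3 : (minpoly ℚ η).natDegree = d - 1 := by
      rw [← cyclotomic_eq_minpoly_rat hη hd.pos, natDegree_cyclotomic, Nat.totient_prime hd]
    omega
  intro j hj
  have := congrArg (fun q : ℚ[X] => q.coeff j) hp0
  simp only [hp, finsetSum_coeff, coeff_C_mul_X_pow, Finset.sum_ite_eq, Finset.mem_range, hj,
    if_true, coeff_zero] at this
  exact_mod_cast sub_eq_zero.mp this

/-- A sum of `d` terms `±1`, `d` odd, is odd (hence non-zero). -/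
theorem sum_pm_one_ne_zero {d : ℕ} (hodd : Odd d) (b : ℕ → ℤ) (hb : ∀ j < d, b j = 1 ∨ b j = -1) :
    ∑ j ∈ range d, b j ≠ 0 := by
  intro h0
  have h2 : ((∑ j ∈ range d, b j : ℤ) : ZMod 2) = 1 := by
    push_cast
    rw [Finset.sum_congr rfl (fun j hj => ?_), Finset.sum_const, card_range, nsmul_eq_mul,
      mul_one, ZMod.natCast_eq_one_iff_odd]
    · exact hodd
    · show ((b j : ℤ) : ZMod 2) = 1
      rcases hb j (Finset.mem_range.mp hj) with h | h <;> rw [h] <;> decide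
  rw [h0] at h2
  exact absurd h2 (by decide)

section Cyclic

variable {G : Type*} [CommGroup G] [Fintype G] [DecidableEq G]

/-- Yanai 1985, Lemma p.171, the printed proof ("by Kubota [1], there exists an odd character χ
of G₀ such that Σ_{s∈S} χ(s) = 0 (*) … The order of χ must be 2d from (*) … ζ = χ(γ) is a primitive
2d-th root of unity.  Hence (*) must be of the form [a full coset pattern].  This implies that the
CM-type is not simple"), in the contrapositive: for a SIMPLE CM-type `(G, {1}, S̃)` on a cyclic
group of order `2d`, `d` an odd prime, EVERY odd character has `Σ_{s∈S̃} χ(s) ≠ 0`. -/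
theorem charSum_ne_zero_of_odd_of_cyclic {γ : G} (hγ : ∀ x, x ∈ Subgroup.zpowers γ) {d : ℕ}
    (hd : d.Prime) (hd2 : d ≠ 2) (hcard : Fintype.card G = 2 * d) (T : CMTriple G)
    (hH : T.H = ⊥) (hs : T.IsSimple) (χ : G →* ℂˣ) (hχ : χ T.ρ = -1) :
    (∑ s ∈ T.S, (χ s : ℂ)) ≠ 0 := by
  have hodd : Odd d := hd.eq_two_or_odd'.resolve_left hd2
  have hd1 : 1 < d := hd.one_lt
  have hord : orderOf γ = 2 * d := by
    rw [orderOf_eq_card_of_forall_mem_zpowers hγ, Nat.card_eq_fintype_card, hcard]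
  have hpow : ∀ x : G, ∃ j : ℕ, γ ^ j = x := fun x =>
    (Submonoid.mem_powers_iff x γ).mp (mem_powers_iff_mem_zpowers.mpr (hγ x))
  -- `ρ = γ ^ d`: the unique element of order 2
  have hρ : T.ρ = γ ^ d := by
    obtain ⟨k, hk⟩ := hpow T.ρ
    have h2 : γ ^ (k * 2) = 1 := by rw [pow_mul, hk, sq, T.ρ_mul_self]
    have hdvd : d * 2 ∣ k * 2 := by
      have := orderOf_dvd_of_pow_eq_one h2
      rwa [hord, mul_comm 2 d] at this
    obtain ⟨q, rfl⟩ := Nat.dvd_of_mul_dvd_mul_right (by norm_num) hdvd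
    have hmod : γ ^ (d * q) = γ ^ (d * (q % 2)) := by
      rw [← pow_mod_orderOf, hord, mul_comm 2 d, Nat.mul_mod_mul_left]
    rcases Nat.mod_two_eq_zero_or_one q with hq | hq
    · exfalso
      apply T.ρ_ne_one
      rw [← hk, hmod, hq, mul_zero, pow_zero]
    · rw [← hk, hmod, hq, mul_one]
  set ω : ℂ := (χ γ : ℂ) with hω
  have hωd : ω ^ d = -1 := by
    rw [hω, ← Units.val_pow_eq_pow_val, ← map_pow, ← hρ, hχ]; simp
  -- re-index the sum along `j ↦ γ ^ j`, `j < 2d`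
  have hinj : ∀ x ∈ range (2 * d), ∀ y ∈ range (2 * d), γ ^ x = γ ^ y → x = y := by
    intro x hx y hy hxy
    exact pow_injOn_Iio_orderOf (by simpa [hord] using hx) (by simpa [hord] using hy) hxy
  have himage : (range (2 * d)).image (fun j => γ ^ j) = univ := by
    apply Finset.eq_univ_of_card
    rw [Finset.card_image_of_injOn (fun x hx y hy hxy => hinj x (by simpa using hx) y
      (by simpa using hy) hxy), card_range, hcard]
  have hsum1 : (∑ s ∈ T.S, (χ s : ℂ)) =
      ∑ j ∈ range (2 * d), if γ ^ j ∈ T.S then ω ^ j else 0 := by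
    calc (∑ s ∈ T.S, (χ s : ℂ)) = ∑ s ∈ univ, if s ∈ T.S then (χ s : ℂ) else 0 := by
          rw [← Finset.sum_filter]
          congr 1
          ext s; simp
      _ = ∑ s ∈ (range (2 * d)).image (fun j => γ ^ j), if s ∈ T.S then (χ s : ℂ) else 0 := by
          rw [himage]
      _ = ∑ j ∈ range (2 * d), if γ ^ j ∈ T.S then (χ (γ ^ j) : ℂ) else 0 :=
          Finset.sum_image hinj
      _ = ∑ j ∈ range (2 * d), if γ ^ j ∈ T.S then ω ^ j else 0 := by
          refine Finset.sum_congr rfl (fun j _ => ?_)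
          rw [hω, map_pow, Units.val_pow_eq_pow_val]
  -- fold the two halves: `ε j = ±1`
  set ε : ℕ → ℤ := fun j => if γ ^ j ∈ T.S then 1 else -1 with hε
  have hε_pm : ∀ j, ε j = 1 ∨ ε j = -1 := fun j => by
    simp only [hε]; split_ifs <;> simp
  have hmem_half : ∀ j, γ ^ (d + j) ∈ T.S ↔ γ ^ j ∉ T.S := fun j => by
    rw [pow_add, ← hρ, mul_comm, T.mul_ρ_mem_iff]
  have hsum2 : (∑ s ∈ T.S, (χ s : ℂ)) = ∑ j ∈ range d, (ε j : ℂ) * ω ^ j := by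
    rw [hsum1, two_mul, Finset.sum_range_add, ← Finset.sum_add_distrib]
    refine Finset.sum_congr rfl (fun j _ => ?_)
    simp only [hε]
    by_cases hj : γ ^ j ∈ T.S
    · rw [if_pos hj, if_neg (by rw [hmem_half]; exact not_not.mpr hj), if_pos hj]
      push_cast; ring
    · rw [if_neg hj, if_pos ((hmem_half j).mpr hj), if_neg hj, pow_add, hωd]
      push_cast; ring
  rw [hsum2]
  -- case A: `χ γ = −1` (order 2): a sum of `d` terms `±1`, `d` odd
  by_cases hω1 : ω = -1
  · rw [hω1]
    have : ∑ j ∈ range d, (ε j : ℂ) * (-1) ^ j =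
        ((∑ j ∈ range d, ε j * (-1) ^ j : ℤ) : ℂ) := by
      simp only [Int.cast_sum, Int.cast_mul, Int.cast_pow, Int.cast_neg, Int.cast_one]
    rw [this]
    refine Int.cast_ne_zero.mpr (sum_pm_one_ne_zero hodd _ (fun j _ => ?_))
    rcases hε_pm j with h | h <;> rcases neg_one_pow_eq_or ℤ j with h' | h' <;>
      simp [h, h']
  -- case B: `η = −χ γ` is a primitive `d`-th root of unity; the relation forces a coset pattern
  · obtain ⟨η, hη⟩ : ∃ η : ℂ, η = -ω := ⟨-ω, rfl⟩
    have hωη : ω = -η := by rw [hη, neg_neg]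
    have hη1 : η ^ d = 1 := by rw [hη, neg_pow, hωd, hodd.neg_one_pow]; ring
    have hη2 : η ≠ 1 := by
      intro h; apply hω1; rw [hη] at h; exact neg_eq_iff_eq_neg.mp h
    have hprim : IsPrimitiveRoot η d := by
      rcases (Nat.dvd_prime hd).mp (orderOf_dvd_of_pow_eq_one hη1) with h1 | h1
      · exact absurd (orderOf_eq_one_iff.mp h1) hη2
      · exact h1 ▸ IsPrimitiveRoot.orderOf η
    intro h0
    -- rewrite the relation in terms of `η`
    set a : ℕ → ℤ := fun j => ε j * (-1) ^ j with ha
    have hrel : ∑ j ∈ range d, (a j : ℂ) * η ^ j = 0 := by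
      rw [← h0]
      refine Finset.sum_congr rfl (fun j _ => ?_)
      rw [hωη, neg_pow, ha]
      push_cast; ring
    have hall := coeffs_eq_of_sum_pow_eq_zero hd hprim a hrel
    set c : ℤ := a (d - 1) with hc
    have hεc : ∀ j < d, ε j = c * (-1) ^ j := by
      intro j hj
      have := hall j hj
      rw [ha] at this
      simp only at this
      rw [← this, mul_assoc, ← sq, ← pow_mul, mul_comm j 2, pow_mul]
      simp
    -- membership pattern for every exponent
    have hc_pm : c = 1 ∨ c = -1 := by
      rcases hε_pm (d - 1) with h | h <;> rcases neg_one_pow_eq_or ℤ (d - 1) with h' | h' <;>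
        simp [hc, ha, h, h']
    have hmem_lt : ∀ j < d, (γ ^ j ∈ T.S ↔ c * (-1) ^ j = 1) := by
      intro j hj
      rw [← hεc j hj, hε]
      simp only
      split_ifs with h <;> simp [h]
    have hmem_ge : ∀ j < d, (γ ^ (d + j) ∈ T.S ↔ c * (-1) ^ (d + j) = 1) := by
      intro j hj
      rw [hmem_half, hmem_lt j hj, pow_add, hodd.neg_one_pow]
      rcases hc_pm with h | h <;> rcases neg_one_pow_eq_or ℤ j with h' | h' <;> simp [h, h']
    have hmem_lt2 : ∀ j < 2 * d, (γ ^ j ∈ T.S ↔ c * (-1) ^ j = 1) := by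
      intro j hj
      by_cases hjd : j < d
      · exact hmem_lt j hjd
      · obtain ⟨i, rfl⟩ : ∃ i, j = d + i := ⟨j - d, by omega⟩
        exact hmem_ge i (by omega)
    have hmem : ∀ j, (γ ^ j ∈ T.S ↔ c * (-1) ^ j = 1) := by
      intro j
      have h1 : γ ^ j = γ ^ (j % (2 * d)) := by rw [pow_mod_orderOf γ j |>.symm, hord]
      have h2 : (-1 : ℤ) ^ j = (-1) ^ (j % (2 * d)) := by
        rw [neg_one_pow_eq_pow_mod_two, neg_one_pow_eq_pow_mod_two (n := j % (2 * d)),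
          Nat.mod_mod_of_dvd j (dvd_mul_right 2 d)]
      rw [h1, h2]
      exact hmem_lt2 _ (Nat.mod_lt _ (by omega))
    -- hence `γ² S̃ = S̃`, contradicting simplicity
    have hsub : γ ^ 2 • T.S ⊆ T.S := by
      intro x hx
      rw [Finset.mem_smul_finset] at hx
      obtain ⟨y, hy, rfl⟩ := hx
      obtain ⟨j, rfl⟩ := hpow y
      rw [smul_eq_mul, ← pow_add, hmem, pow_add]
      rw [hmem] at hy
      simpa using hy
    have heq : γ ^ 2 • T.S = T.S :=
      Finset.eq_of_subset_of_card_le hsub (by rw [Finset.card_smul_finset])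
    have hγ2 : γ ^ 2 = 1 := by
      have := hs (γ ^ 2) heq
      rwa [hH, Subgroup.mem_bot] at this
    have := orderOf_dvd_of_pow_eq_one hγ2
    rw [hord] at this
    have := Nat.le_of_dvd (by norm_num) this
    omega

end Cyclic

/-- **Yanai 1985, Lemma p.171, follows from Kubota's character formula**: on a cyclic group of
order `2d`, `d` an odd prime, every simple CM-type `(G, {1}, S̃)` is nondegenerate — by
`Kubota_rank_abelian_charFormula` the rank is `1 + #{odd χ : Σ_S̃ χ ≠ 0}`, every odd character has
`Σ_S̃ χ ≠ 0` (`charSum_ne_zero_of_odd_of_cyclic`, Yanai's printed argument), and there are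
`d = |G|/2` odd characters (`two_mul_card_odd_char`), so `rank = d + 1`.
[cite: Yanai1985, Lemma p.171; Kubota1965, Lemma 2] -/
theorem Yanai1985_lemma_cyclic_nondegenerate_of_charFormula
    (hK : Kubota_rank_abelian_charFormula) : Yanai1985_lemma_cyclic_nondegenerate := by
  intro d hd hd2 G _ _ _ _ hcard T hH hs
  letI : CommGroup G := IsCyclic.commGroup
  obtain ⟨γ, hγ⟩ := IsCyclic.exists_generator (α := G)
  have hrank := hK G T hH
  have hodd := two_mul_card_odd_char (G := G) T.ρ_ne_one T.ρ_mul_self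
  have hkey : ∀ χ : G →* ℂˣ, χ T.ρ = -1 → (∑ s ∈ T.S, (χ s : ℂ)) ≠ 0 :=
    fun χ hχ => charSum_ne_zero_of_odd_of_cyclic hγ hd hd2 hcard T hH hs χ hχ
  have hfull : Nat.card {χ : G →* ℂˣ // χ T.ρ = -1 ∧ (∑ s ∈ T.S, (χ s : ℂ)) ≠ 0} =
      Nat.card {χ : G →* ℂˣ // χ T.ρ = -1} :=
    Nat.card_congr (Equiv.subtypeEquivRight (fun χ => ⟨fun h => h.1, fun h => ⟨h, hkey χ h⟩⟩))
  have hd' : T.dim = d := by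
    have := T.two_mul_card_S
    have := T.dim_eq_card_S_of_H_eq_bot hH
    omega
  have hG : Nat.card G = Fintype.card G := Nat.card_eq_fintype_card
  unfold CMTriple.IsNondegenerate
  omega

end HodgeRepro.Lit2
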